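import Summits.Langlands.Langlands.Theorems.RationalPeriodQuarterProjectionAlg

/-!
# `RationalPeriodQuarter` — semi-analytic lifting (piece B of the `AnalyticCoboundarySplit` of stmt-Langlands-2805)

Pure one-variable function theory, Mathlib only.  If every `r γ` (`γ ∈ Γ₁(N)`) is real-analytic on `ℝ`, `f` is
real-analytic off a finite set `F` and `r γ = f|γ - f` cofinitely (`|` = the route's `slashHalf`), then there is a
`g`, real-analytic on all of `ℝ` and equal to `f` off `F`, with `r γ = g|γ - g` cofinitely.  Mechanism: for `x ∈ F`
choose `k ∈ ℕ` with `x + k ∉ F`; the translation `T^k = (1 k; 0 1) ∈ Γ₁(N)` gives `f = f(· + k) - r_(T^k)` on a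
punctured neighbourhood of `x`, and the right side is analytic AT `x`; redefine `f` on `F`; Möbius fibres of finite
sets are finite (`rpq_finite_moebius_fibre`).  The statement is the hypothesis `hB` of
`periodClassNontrivialQuarter_of_split` verbatim (route `let`s inlined).
-/

set_option linter.dupNamespace false

namespace Summit.Langlands.Langlands.Theorems

open Filter Set Topology

/-- On `ℝ`, a cofinitely-true property holds on every punctured neighbourhood. -/
theorem rpq_eventually_nhdsNE_of_cofinite {p : ℝ → Prop} (h : ∀ᶠ (t : ℝ) in Filter.cofinite, p t) (x : ℝ) :
    ∀ᶠ (t : ℝ) in 𝓝[≠] x, p t := by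
  rw [Filter.eventually_cofinite] at h
  have hc : IsClosed ({t : ℝ | ¬ p t} \ {x}) := (h.subset Set.sdiff_subset).isClosed
  have h1 : ∀ᶠ (t : ℝ) in 𝓝 x, t ∈ ({t : ℝ | ¬ p t} \ {x})ᶜ :=
    hc.isOpen_compl.mem_nhds (by simp)
  have h2 : ∀ᶠ (t : ℝ) in 𝓝[≠] x, t ∈ ({x}ᶜ : Set ℝ) := self_mem_nhdsWithin
  filter_upwards [eventually_nhdsWithin_of_eventually_nhds h1, h2] with t ht htx
  by_contra hpt
  exact ht ⟨hpt, htx⟩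

/-- **Semi-analytic lifting** (piece B of the split of `RationalPeriodQuarter.PeriodClassNontrivialQuarter`). -/
theorem semiAnalyticLifting_statement :
    (let slashHalf : Matrix.SpecialLinearGroup (Fin 2) ℤ → (ℝ → ℂ) → ℝ → ℂ := fun g φ t => ((|((g : Matrix (Fin 2) (Fin 2) ℤ) 1 0 : ℝ) * t + ((g : Matrix (Fin 2) (Fin 2) ℤ) 1 1 : ℝ)|⁻¹ : ℝ) : ℂ) * φ ((((g : Matrix (Fin 2) (Fin 2) ℤ) 0 0 : ℝ) * t + ((g : Matrix (Fin 2) (Fin 2) ℤ) 0 1 : ℝ)) / (((g : Matrix (Fin 2) (Fin 2) ℤ) 1 0 : ℝ) * t + ((g : Matrix (Fin 2) (Fin 2) ℤ) 1 1 : ℝ))); let IsSemiAnalytic : (ℝ → ℂ) → Prop := fun f => ∃ F : Finset ℝ, AnalyticOnNhd ℝ f ((↑F : Set ℝ)ᶜ); ∀ N : ℕ, 0 < N → ∀ (r : Matrix.SpecialLinearGroup (Fin 2) ℤ → ℝ → ℂ) (f : ℝ → ℂ), (∀ γ ∈ CongruenceSubgroup.Gamma1 N, AnalyticOnNhd ℝ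 (r γ) Set.univ) → IsSemiAnalytic f → (∀ γ ∈ CongruenceSubgroup.Gamma1 N, ∀ᶠ t in Filter.cofinite, r γ t = slashHalf γ f t - f t) → ∃ g : ℝ → ℂ, AnalyticOnNhd ℝ g Set.univ ∧ ∀ γ ∈ CongruenceSubgroup.Gamma1 N, ∀ᶠ t in Filter.cofinite, r γ t = slashHalf γ g t - g t) := by
  intro slashHalf IsSemiAnalytic N hN r f hr hsa hcob
  classical
  obtain ⟨F, hF⟩ := hsa
  -- (1) the translations `T^k ∈ Γ₁(N)` and their coboundary equations
  let Tk : ℕ → Matrix.SpecialLinearGroup (Fin 2) ℤ := fun k =>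
    ⟨!![1, (k : ℤ); 0, 1], by norm_num [Matrix.det_fin_two_of]⟩
  have hTk : ∀ k, Tk k ∈ CongruenceSubgroup.Gamma1 N := by
    intro k
    rw [CongruenceSubgroup.Gamma1_mem]
    refine ⟨?_, ?_, ?_⟩ <;> simp [Tk]
  have hE : ∀ k : ℕ, ∀ᶠ (t : ℝ) in Filter.cofinite, r (Tk k) t = f (t + k) - f t := by
    intro k
    refine (hcob (Tk k) (hTk k)).mono fun t ht => ?_
    have h00 : (((Tk k : Matrix (Fin 2) (Fin 2) ℤ) 0 0 : ℤ) : ℝ) = 1 := by simp [Tk]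
    have h01 : (((Tk k : Matrix (Fin 2) (Fin 2) ℤ) 0 1 : ℤ) : ℝ) = k := by simp [Tk]
    have h10 : (((Tk k : Matrix (Fin 2) (Fin 2) ℤ) 1 0 : ℤ) : ℝ) = 0 := by simp [Tk]
    have h11 : (((Tk k : Matrix (Fin 2) (Fin 2) ℤ) 1 1 : ℤ) : ℝ) = 1 := by simp [Tk]
    simp only [slashHalf, h00, h01, h10, h11, zero_mul, zero_add, abs_one, inv_one,
      Complex.ofReal_one, one_mul, div_one] at ht
    exact ht
  -- (2) at every point `f` agrees, on a punctured neighbourhood, with a germ analytic AT the point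
  have hgerm : ∀ x : ℝ, ∃ h : ℝ → ℂ, AnalyticAt ℝ h x ∧ ∀ᶠ (t : ℝ) in 𝓝[≠] x, f t = h t := by
    intro x
    have hfin : Set.Finite {k : ℕ | x + (k : ℝ) ∈ (F : Set ℝ)} := by
      refine Set.Finite.of_finite_image (f := fun k : ℕ => x + (k : ℝ)) ?_ ?_
      · exact F.finite_toSet.subset (by rintro _ ⟨k, hk, rfl⟩; exact hk)
      · intro k _ k' _ hkk'
        have : (k : ℝ) = k' := add_left_cancel hkk'
        exact_mod_cast this
    obtain ⟨k, hk⟩ : ∃ k : ℕ, x + (k : ℝ) ∉ (F : Set ℝ) := by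
      by_contra hall
      push Not at hall
      exact Set.infinite_univ (hfin.subset fun k _ => hall k)
    refine ⟨fun t => f (t + k) - r (Tk k) t, ?_, ?_⟩
    · have hfa : AnalyticAt ℝ f (x + k) := hF _ hk
      have h1 : AnalyticAt ℝ (fun t : ℝ => f (t + k)) x :=
        hfa.comp_of_eq (analyticAt_id.add analyticAt_const) rfl
      exact h1.sub (hr (Tk k) (hTk k) x (Set.mem_univ _))
    · filter_upwards [rpq_eventually_nhdsNE_of_cofinite (hE k) x] with t ht
      rw [ht]
      ring
  choose H hHan hHeq using hgerm
  -- (3) redefine `f` on `F`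
  let g : ℝ → ℂ := fun x => if x ∈ (F : Set ℝ) then H x x else f x
  have hgf : ∀ x, x ∉ (F : Set ℝ) → g x = f x := fun x hx => by
    show (if x ∈ (F : Set ℝ) then H x x else f x) = f x
    rw [if_neg hx]
  have hFc : ∀ᶠ (t : ℝ) in Filter.cofinite, t ∉ (F : Set ℝ) :=
    F.finite_toSet.eventually_cofinite_notMem
  have hgF : ∀ᶠ (t : ℝ) in Filter.cofinite, g t = f t := hFc.mono fun t ht => hgf t ht
  have hFne : ∀ x : ℝ, ∀ᶠ (t : ℝ) in 𝓝[≠] x, t ∉ (F : Set ℝ) := fun x =>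
    rpq_eventually_nhdsNE_of_cofinite hFc x
  have hgan : AnalyticOnNhd ℝ g Set.univ := by
    intro x _
    by_cases hx : x ∈ (F : Set ℝ)
    · have h1 : ∀ᶠ (t : ℝ) in 𝓝[≠] x, g t = H x t := by
        filter_upwards [hFne x, hHeq x] with t ht1 ht2
        rw [hgf t ht1, ht2]
      have h2 : ∀ᶠ (t : ℝ) in 𝓝 x, g t = H x t := by
        rw [← nhdsNE_sup_pure x, Filter.eventually_sup, Filter.eventually_pure]
        refine ⟨h1, ?_⟩
        show (if x ∈ (F : Set ℝ) then H x x else f x) = H x x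
        rw [if_pos hx]
      exact (hHan x).congr (h2.mono fun t ht => ht.symm)
    · have h1 : ∀ᶠ (t : ℝ) in 𝓝 x, t ∉ (F : Set ℝ) :=
        F.finite_toSet.isClosed.isOpen_compl.mem_nhds hx
      exact (hF x hx).congr (h1.mono fun t ht => (hgf t ht).symm)
  -- (4) the coboundary equations transfer from `f` to `g`
  refine ⟨g, hgan, fun γ hγ => ?_⟩
  have hdetZ : ((γ : Matrix (Fin 2) (Fin 2) ℤ) 0 0 : ℤ) * (γ : Matrix (Fin 2) (Fin 2) ℤ) 1 1 -
      (γ : Matrix (Fin 2) (Fin 2) ℤ) 0 1 * (γ : Matrix (Fin 2) (Fin 2) ℤ) 1 0 = 1 := by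
    have := Matrix.SpecialLinearGroup.det_coe γ
    rwa [Matrix.det_fin_two] at this
  have hdet : ((γ : Matrix (Fin 2) (Fin 2) ℤ) 0 0 : ℝ) * ((γ : Matrix (Fin 2) (Fin 2) ℤ) 1 1 : ℝ) -
      ((γ : Matrix (Fin 2) (Fin 2) ℤ) 0 1 : ℝ) * ((γ : Matrix (Fin 2) (Fin 2) ℤ) 1 0 : ℝ) = 1 := by
    exact_mod_cast hdetZ
  have h4 : ∀ᶠ (t : ℝ) in Filter.cofinite,
      g ((((γ : Matrix (Fin 2) (Fin 2) ℤ) 0 0 : ℝ) * t + ((γ : Matrix (Fin 2) (Fin 2) ℤ) 0 1 : ℝ)) /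
          (((γ : Matrix (Fin 2) (Fin 2) ℤ) 1 0 : ℝ) * t + ((γ : Matrix (Fin 2) (Fin 2) ℤ) 1 1 : ℝ))) =
        f ((((γ : Matrix (Fin 2) (Fin 2) ℤ) 0 0 : ℝ) * t + ((γ : Matrix (Fin 2) (Fin 2) ℤ) 0 1 : ℝ)) /
          (((γ : Matrix (Fin 2) (Fin 2) ℤ) 1 0 : ℝ) * t + ((γ : Matrix (Fin 2) (Fin 2) ℤ) 1 1 : ℝ))) := by
    rw [Filter.eventually_cofinite] at hgF ⊢
    exact hgF.preimage' fun y _ => rpq_finite_moebius_fibre _ _ _ _ hdet y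
  filter_upwards [hcob γ hγ, hgF, h4] with t h1 h2 h3
  simp only [slashHalf] at h1 ⊢
  rw [h1, h3, h2]

end Summit.Langlands.Langlands.Theorems
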